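import Literature.Geometry.Riemannian.ShrinkerEntropyProofs
import Literature.Geometry.Riemannian.ShrinkerPotentialGrowthProofs
import Literature.Geometry.Riemannian.ShrinkerScalarCurvatureNonnegHolds
import Summits.SmoothPoincare4.SmoothPoincare4.Theorems.EntropyRungNoncompactShrinkerGapStubCompactSupportLSIMixture
import HarnessLib

/-!
# H¹ cut-offs on a complete gradient shrinker (crux `EntropyRung.NoncompactShrinkerGap`,
# stmt-SmoothPoincare4-10868, line `collapsed-ends-usc`, v13)

Helper `helper_shrinkerCutoff` of the heat-flow proof of the compact-support logarithmic Sobolev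
inequality on a complete connected normalised gradient shrinking Ricci soliton `(M, g, f)`
(`Ric + Hess f = ½ g`, `R + |∇f|² = f`, closed `g`-balls compact): there are cut-off functions
`η_k = ψ(f/(k+1))` (`ψ` a smooth antitone profile, `ψ = 1` on `(−∞, 1]`, `ψ = 0` on `[2, ∞)`) and a
constant `C` with `η_k` smooth, compactly supported, `0 ≤ η_k ≤ η_{k+1} ≤ 1`, `η_k = 1` near every
point of `{f < k+1}`, `|∇η_k|² ≤ C/(k+1)`, `|Δη_k| ≤ C`, `|⟨∇f, ∇η_k⟩| ≤ C`.

The mathematics (folklore; the cut-off argument of Carrillo–Ni 2009, §4, on the complete soliton):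
`R ≥ 0` (Zhang 2009 / Chen 2009, the tree's `Zhang2009.minimumPrinciple_core` +
`directionalComparison_core`), hence `0 ≤ |∇f|² ≤ f` and `f` is proper (Haslhofer–Müller 2011,
Lemma 2.1: a minimum point and the lower growth `¼(r − 5n)₊² ≤ f`); `Δf = n/2 − R`, so
`|Δf| ≤ n/2 + f`. By the chain rules `dη_k = ψ'(f/(k+1)) df/(k+1)` and
`Δη_k = ψ''(f/(k+1)) |∇f|²/(k+1)² + ψ'(f/(k+1)) Δf/(k+1)`, and since `ψ'`, `ψ''` are bounded and
vanish where `f > 2(k+1)`, on the support `|∇f|² ≤ f ≤ 2(k+1)` gives the three bounds with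
`C = 2C₁² + 2C₁ + C₁ n/2 + 2C₂`.
-/

noncomputable section

set_option linter.dupNamespace false

open scoped Manifold ContDiff ENNReal NNReal Topology
open MeasureTheory Set Filter
open Literature.Geometry.Lorentzian Literature.Geometry.Riemannian

namespace Summit.SmoothPoincare4.SmoothPoincare4.Theorems.NoncompactShrinkerGapHeat

open Summit.SmoothPoincare4.SmoothPoincare4.Theorems.NoncompactShrinkerGapCompactSupportLSI

/-- A smooth antitone cut-off profile `ψ : ℝ → ℝ` (`ψ = 1` on `(−∞, 1]`, `ψ = 0` on `[2, ∞)`,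
`0 ≤ ψ ≤ 1`) together with the facts used by the cut-off argument: `ψ'` and `ψ''` vanish on
`(2, ∞)` and are bounded (they are continuous with compact support in `[1, 2]`). [folklore] -/
theorem exists_cutoffProfile_deriv_bounds :
    ∃ ψ : ℝ → ℝ, ContDiff ℝ ∞ ψ ∧ (∀ t ≤ 1, ψ t = 1) ∧ (∀ t, 2 ≤ t → ψ t = 0) ∧
      (∀ t, 0 ≤ ψ t ∧ ψ t ≤ 1) ∧ Antitone ψ ∧ (∀ t, 2 < t → deriv ψ t = 0) ∧
      (∀ t, 2 < t → deriv (deriv ψ) t = 0) ∧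
      ∃ C₁ C₂ : ℝ, 0 ≤ C₁ ∧ 0 ≤ C₂ ∧ (∀ t, |deriv ψ t| ≤ C₁) ∧
        ∀ t, |deriv (deriv ψ) t| ≤ C₂ := by
  obtain ⟨ψ, hψs, hψ1, hψ0, hψ01, hanti⟩ := CarrilloNi2009_shrinkerLSI.exists_antitone_cutoffProfile
  have hd1 : ContDiff ℝ ∞ (deriv ψ) := (contDiff_infty_iff_deriv.mp hψs).2
  have hd1c : Continuous (deriv ψ) := hd1.continuous
  have hd2c : Continuous (deriv (deriv ψ)) := hd1.continuous_deriv ENat.LEInfty.out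
  -- `ψ' = 0` off `[1, 2]`
  have hlow : ∀ t < 1, deriv ψ t = 0 := fun t ht ↦ by
    have hev : ψ =ᶠ[𝓝 t] fun _ ↦ (1 : ℝ) := by
      filter_upwards [Iio_mem_nhds ht] with s hs
      exact hψ1 s (le_of_lt hs)
    rw [hev.deriv_eq, deriv_const]
  have hhigh : ∀ t, 2 < t → deriv ψ t = 0 := fun t ht ↦ by
    have hev : ψ =ᶠ[𝓝 t] fun _ ↦ (0 : ℝ) := by
      filter_upwards [Ioi_mem_nhds ht] with s hs
      exact hψ0 s (le_of_lt hs)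
    rw [hev.deriv_eq, deriv_const]
  have hhigh2 : ∀ t, 2 < t → deriv (deriv ψ) t = 0 := fun t ht ↦ by
    have hev : deriv ψ =ᶠ[𝓝 t] fun _ ↦ (0 : ℝ) := by
      filter_upwards [Ioi_mem_nhds ht] with s hs
      exact hhigh s hs
    rw [hev.deriv_eq, deriv_const]
  have hsupp : HasCompactSupport (deriv ψ) := by
    refine HasCompactSupport.intro (K := Icc (1 : ℝ) 2) isCompact_Icc fun t ht ↦ ?_
    rw [mem_Icc, not_and_or, not_le, not_le] at ht
    rcases ht with ht | ht
    · exact hlow t ht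
    · exact hhigh t ht
  have hsupp2 : HasCompactSupport (deriv (deriv ψ)) := hsupp.deriv
  obtain ⟨C₁, hC₁⟩ := hd1c.bounded_above_of_compact_support hsupp
  obtain ⟨C₂, hC₂⟩ := hd2c.bounded_above_of_compact_support hsupp2
  refine ⟨ψ, hψs, hψ1, hψ0, hψ01, hanti, hhigh, hhigh2, C₁, C₂, (norm_nonneg _).trans (hC₁ 0),
    (norm_nonneg _).trans (hC₂ 0), fun t ↦ ?_, fun t ↦ ?_⟩
  · simpa [Real.norm_eq_abs] using hC₁ t
  · simpa [Real.norm_eq_abs] using hC₂ t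

/-- **H¹ cut-offs on a complete gradient shrinker** (the cut-off family of the exhaustion argument
of Carrillo–Ni 2009, §4, with the potential `f` as exhaustion function — proper by Haslhofer–Müller
2011, Lemma 2.1, once `R ≥ 0`, Zhang 2009). On a complete connected normalised gradient shrinker
`(M, g, f)` there are `η : ℕ → M → ℝ` and `C` with: every `η k` smooth, compactly supported,
`0 ≤ η k ≤ η (k+1) ≤ 1`, `η k = 1` near every point of `{f < k+1}`, `|∇η_k|² ≤ C/(k+1)`,
`|Δη_k| ≤ C`, `|g⁻¹(df, dη_k)| ≤ C`. Take `η k = ψ (f/(k+1))` for a smooth antitone profile `ψ`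
(`= 1` on `(−∞,1]`, `= 0` on `[2,∞)`); the bounds follow from the chain rules for `d`, `|∇·|²`
and `Δ` of a composite, `|∇f|² ≤ f ≤ 2(k+1)` on the support of `ψ'(f/(k+1))`, and
`|Δf| = |n/2 − R| ≤ n/2 + f`. [cite: CarrilloNi2009, §4 (integration by parts on the complete soliton)]
[cite: HaslhoferMuller2011, Lemma 2.1 (p. 5)] [cite: Zhang2009, Thm. 1.3 (ii)] -/
theorem helper_shrinkerCutoff : ∀ (n : ℕ) (M : Type*) [TopologicalSpace M] [T2Space M] [SecondCountableTopology M] [ChartedSpace (EuclideanSpace ℝ (Fin n)) M] [IsManifold (𝓡 n) ∞ M] [ConnectedSpace M] [T3Space M] [MeasurableSpace M] [BorelSpace M] (g : PseudoRiemannianMetric (𝓡 n) ∞ (EuclideanSpace ℝ (Fin n)) (TangentSpace (𝓡 n) : M → Type _)) [g.HasLeviCivita] (f : M → ℝ) (hg : g.IsRiemannian), (∀ (x : M) (r : NNReal), IsCompact {y : M | g.edist hg x y ≤ r}) → ContMDiff (𝓡 n) 𝓘(ℝ, ℝ) ∞ f → (∀ (x : M) (X Y : TangentSpace (𝓡 n)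 x), g.ricci x X Y + g.hessian f x X Y = (1 / 2 : ℝ) * g.val x X Y) → (∀ x : M, g.scalarCurvature x + g.gradSq f x = f x) → ∃ (η : ℕ → M → ℝ) (C : ℝ), (∀ k, ContMDiff (𝓡 n) 𝓘(ℝ, ℝ) ∞ (η k)) ∧ (∀ k, HasCompactSupport (η k)) ∧ (∀ k x, 0 ≤ η k x ∧ η k x ≤ 1) ∧ (∀ k x, η k x ≤ η (k + 1) x) ∧ (∀ (k : ℕ) (x : M), f x < k + 1 → ∀ᶠ y in 𝓝 x, η k y = 1) ∧ (∀ k x, g.gradSq (η k) x ≤ C / (k + 1)) ∧ (∀ k x, |g.dalembertian (η k) x| ≤ C) ∧ (∀ k x, |g.innerDual x (mvfderiv (𝓡 n) f x).toLinearMap (mvfderiv (𝓡 n) (η k) x).toLinearMap| ≤ C) := by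
  intro n M _ _ _ _ _ _ _ _ _ g _ f hg hc hf hsol hnorm
  classical
  /- `R ≥ 0` (Zhang 2009), `0 ≤ |∇f|² ≤ f`, `|Δf| ≤ n/2 + f`, properness of `f` -/
  have hk1 : ((1 : ℕ∞) : ℕ∞ω) + 1 ≤ (∞ : ℕ∞ω) := by
    rw [show ((1 : ℕ∞) : ℕ∞ω) + 1 = 2 by norm_num]
    exact WithTop.coe_le_coe.2 le_top
  haveI : CovariantDerivative.ContMDiffCovariantDerivative g.leviCivita 1 :=
    ⟨g.isLocallyContMDiff_leviCivita_holds 1 hk1 univ isOpen_univ⟩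
  haveI : CovariantDerivative.ContMDiffCovariantDerivative g.leviCivita ∞ :=
    ⟨g.isLocallyContMDiff_leviCivita_holds ⊤ (le_of_eq rfl) univ isOpen_univ⟩
  have hS0 : ∀ x, 0 ≤ g.scalarCurvature x := fun x ↦
    Zhang2009.minimumPrinciple_core g hg hc hf hsol
      (fun p ↦ Zhang2009.directionalComparison_core g hg hc hf hsol p) x
  have hgrad : ∀ x, g.gradSq f x ≤ f x := fun x ↦ by linarith [hS0 x, hnorm x]
  have hG0 : ∀ x, 0 ≤ g.gradSq f x := fun x ↦ g.gradSq_nonneg hg f x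
  have hf0 : ∀ x, 0 ≤ f x := fun x ↦ (hG0 x).trans (hgrad x)
  have hΔf : ∀ x, |g.dalembertian f x| ≤ n / 2 + f x := fun x ↦ by
    have h1 := CarrilloNi2009_shrinkerLSI.scalarCurvature_add_dalembertian hsol x
    have hn0 : (0 : ℝ) ≤ n := Nat.cast_nonneg _
    rw [abs_le]
    constructor <;> linarith [hS0 x, hnorm x, hG0 x, hf0 x]
  obtain ⟨p, hp⟩ := HaslhoferMuller.exists_forall_potential_le g hg hc hf hgrad hsol
  have hlow : ∀ (x : M) (r : NNReal), (r : ℝ≥0∞) ≤ g.edist hg p x →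
      (1 / 4 : ℝ) * (max ((r : ℝ) - 5 * n) 0) ^ 2 ≤ f x := fun x r hr ↦ by
    have h := HaslhoferMuller.potential_lower_of_scalarCurvature_nonneg g hg hc hf hsol hnorm
      hS0 hp x r hr
    rwa [finrank_euclideanSpace_fin] at h
  have hprop : ∀ R : ℝ, IsCompact {x | f x ≤ R} :=
    isCompact_sublevel_of_growth hg hf.continuous hc hlow
  /- the profile `ψ`, the rescaled profiles `ζ k = ψ (· / (k+1))` and their derivatives -/
  obtain ⟨ψ, hψs, hψ1, hψ0, hψ01, hanti, hψd0, hψdd0, C₁, C₂, hC₁0, hC₂0, hC₁, hC₂⟩ :=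
    exists_cutoffProfile_deriv_bounds
  have hk : ∀ k : ℕ, (0 : ℝ) < k + 1 := fun k ↦ by positivity
  set ζ : ℕ → ℝ → ℝ := fun k t ↦ ψ (t / (k + 1)) with hζ
  have hζs : ∀ k, ContDiff ℝ ∞ (ζ k) := fun k ↦ hψs.comp (contDiff_id.div_const _)
  have hζd : ∀ (k : ℕ) (t : ℝ), HasDerivAt (ζ k) (deriv ψ (t / (k + 1)) / (k + 1)) t := by
    intro k t
    have h1 : HasDerivAt (fun s : ℝ ↦ s / (k + 1)) (1 / (k + 1)) t := (hasDerivAt_id t).div_const _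
    have h2 : HasDerivAt ψ (deriv ψ (t / (k + 1))) (t / (k + 1)) :=
      (hψs.differentiable (by norm_num) _).hasDerivAt
    simpa [hζ, div_eq_mul_inv, Function.comp_def] using h2.comp t h1
  have hζ' : ∀ k : ℕ, deriv (ζ k) = fun t ↦ deriv ψ (t / (k + 1)) / (k + 1) := fun k ↦
    funext fun t ↦ (hζd k t).deriv
  have hζdd : ∀ (k : ℕ) (t : ℝ),
      deriv (deriv (ζ k)) t = deriv (deriv ψ) (t / (k + 1)) / (k + 1) / (k + 1) := by
    intro k t
    rw [hζ' k]
    have h1 : HasDerivAt (fun s : ℝ ↦ s / (k + 1)) (1 / (k + 1)) t := (hasDerivAt_id t).div_const _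
    have hd1 : ContDiff ℝ ∞ (deriv ψ) := (contDiff_infty_iff_deriv.mp hψs).2
    have h2 : HasDerivAt (deriv ψ) (deriv (deriv ψ) (t / (k + 1))) (t / (k + 1)) :=
      (hd1.differentiable (by norm_num) _).hasDerivAt
    have h3 := (h2.comp t h1).div_const ((k : ℝ) + 1)
    simpa [div_eq_mul_inv, Function.comp_def] using h3.deriv
  /- the cut-offs `η k = ζ k ∘ f` and their differential calculus -/
  set η : ℕ → M → ℝ := fun k x ↦ ζ k (f x) with hη
  have hηζ : ∀ k, η k = ζ k ∘ f := fun k ↦ rfl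
  have hfd : ∀ x, MDifferentiableAt (𝓡 n) 𝓘(ℝ, ℝ) f x := fun x ↦ hf.mdifferentiableAt (by norm_num)
  have hf2 : ∀ x, ContMDiffAt (𝓡 n) 𝓘(ℝ, ℝ) 2 f x := fun x ↦ (hf.of_le ENat.LEInfty.out).contMDiffAt
  have hd : ∀ (k : ℕ) (x : M), (mvfderiv (𝓡 n) (η k) x).toLinearMap =
      (deriv ψ (f x / (k + 1)) / (k + 1)) • (mvfderiv (𝓡 n) f x).toLinearMap := fun k x ↦ by
    ext v
    have := mvfderiv_real_comp_apply (I := 𝓡 n) (hζd k (f x)) (hfd x) v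
    simpa [hη, Function.comp_def] using this
  have hgradη : ∀ (k : ℕ) (x : M),
      g.gradSq (η k) x = (deriv ψ (f x / (k + 1)) / (k + 1)) ^ 2 * g.gradSq f x := fun k x ↦ by
    rw [hηζ]
    exact g.gradSq_real_comp (hζd k (f x)) (hfd x)
  have hcross : ∀ (k : ℕ) (x : M), g.innerDual x (mvfderiv (𝓡 n) f x).toLinearMap
      (mvfderiv (𝓡 n) (η k) x).toLinearMap = deriv ψ (f x / (k + 1)) / (k + 1) * g.gradSq f x :=
    fun k x ↦ by
    rw [hd k x]
    simp only [PseudoRiemannianMetric.innerDual, PseudoRiemannianMetric.gradSq, map_smul,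
      smul_eq_mul]
  have hΔη : ∀ (k : ℕ) (x : M), g.dalembertian (η k) x =
      deriv (deriv ψ) (f x / (k + 1)) / (k + 1) / (k + 1) * g.gradSq f x +
        deriv ψ (f x / (k + 1)) / (k + 1) * g.dalembertian f x := fun k x ↦ by
    have h := g.dalembertian_real_comp (ζ := ζ k) (hf2 x) ((hζs k).of_le ENat.LEInfty.out).contDiffAt
    rw [hηζ, h, hζdd, hζ']
    rfl
  -- off `{f ≤ 2(k+1)}` the derivatives of the profile vanish
  have hfar : ∀ (k : ℕ) (x : M), ¬ f x ≤ 2 * (k + 1) →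
      deriv ψ (f x / (k + 1)) = 0 ∧ deriv (deriv ψ) (f x / (k + 1)) = 0 := by
    intro k x hx
    have h2 : 2 < f x / (k + 1) := by
      rw [lt_div_iff₀ (hk k)]
      linarith [lt_of_not_ge hx]
    exact ⟨hψd0 _ h2, hψdd0 _ h2⟩
  /- the constant -/
  have hCn : (0 : ℝ) ≤ n := Nat.cast_nonneg _
  have hC₁n : 0 ≤ C₁ * n := mul_nonneg hC₁0 hCn
  have hC₁sq : 0 ≤ C₁ ^ 2 := sq_nonneg _
  set C : ℝ := 2 * C₁ ^ 2 + 2 * C₁ + C₁ * n / 2 + 2 * C₂ with hC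
  have hC0 : 0 ≤ C := by linarith
  refine ⟨η, C, fun k ↦ (hζs k).comp_contMDiff hf, ?_, fun k x ↦ hψ01 _, ?_, ?_, ?_, ?_, ?_⟩
  · -- compact support inside `{f ≤ 2(k+1)}`
    intro k
    refine HasCompactSupport.intro (hprop (2 * (k + 1))) fun x hx ↦ ?_
    have hx' : 2 * ((k : ℝ) + 1) < f x := lt_of_not_ge hx
    exact hψ0 _ (by rw [le_div_iff₀ (hk k)]; linarith)
  · -- monotone in `k`
    intro k x
    show ψ (f x / (k + 1)) ≤ ψ (f x / (((k + 1 : ℕ) : ℝ) + 1))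
    push_cast
    exact hanti (div_le_div_of_nonneg_left (hf0 x) (hk k) (by linarith))
  · -- `= 1` near every point of `{f < k+1}`
    intro k x hx
    have hopen : IsOpen {y : M | f y < k + 1} := isOpen_lt hf.continuous continuous_const
    filter_upwards [hopen.mem_nhds hx] with y hy
    show ψ (f y / (k + 1)) = 1
    refine hψ1 _ ?_
    rw [div_le_one (hk k)]
    exact le_of_lt hy
  · -- `|∇η_k|² ≤ C/(k+1)`
    intro k x
    rw [hgradη]
    by_cases hfx : f x ≤ 2 * (k + 1)
    · have ha : deriv ψ (f x / (k + 1)) ^ 2 ≤ C₁ ^ 2 := by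
        rw [← sq_abs]
        exact pow_le_pow_left₀ (abs_nonneg _) (hC₁ _) 2
      calc (deriv ψ (f x / (k + 1)) / (k + 1)) ^ 2 * g.gradSq f x
          ≤ C₁ ^ 2 / (k + 1) ^ 2 * (2 * (k + 1)) := by
            rw [div_pow]
            exact mul_le_mul (div_le_div_of_nonneg_right ha (by positivity))
              ((hgrad x).trans hfx) (hG0 x) (by positivity)
        _ = 2 * C₁ ^ 2 / (k + 1) := by
            field_simp
        _ ≤ C / (k + 1) := div_le_div_of_nonneg_right (by linarith) (hk k).le
    · rw [(hfar k x hfx).1]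
      simpa using div_nonneg hC0 (hk k).le
  · -- `|Δη_k| ≤ C`
    intro k x
    rw [hΔη]
    by_cases hfx : f x ≤ 2 * (k + 1)
    · have hkk : (1 : ℝ) ≤ k + 1 := by linarith [(Nat.cast_nonneg k : (0 : ℝ) ≤ k)]
      calc |deriv (deriv ψ) (f x / (k + 1)) / (k + 1) / (k + 1) * g.gradSq f x +
              deriv ψ (f x / (k + 1)) / (k + 1) * g.dalembertian f x|
          ≤ |deriv (deriv ψ) (f x / (k + 1)) / (k + 1) / (k + 1) * g.gradSq f x| +
              |deriv ψ (f x / (k + 1)) / (k + 1) * g.dalembertian f x| := abs_add_le _ _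
        _ = |deriv (deriv ψ) (f x / (k + 1))| / (k + 1) / (k + 1) * g.gradSq f x +
              |deriv ψ (f x / (k + 1))| / (k + 1) * |g.dalembertian f x| := by
            rw [abs_mul, abs_mul, abs_div, abs_div, abs_div, abs_of_pos (hk k),
              abs_of_nonneg (hG0 x)]
        _ ≤ C₂ / (k + 1) / (k + 1) * (2 * (k + 1)) + C₁ / (k + 1) * (n / 2 + 2 * (k + 1)) := by
            refine add_le_add (mul_le_mul ?_ ((hgrad x).trans hfx) (hG0 x) ?_)
              (mul_le_mul ?_ ((hΔf x).trans (by linarith)) (abs_nonneg _) ?_)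
            · exact div_le_div_of_nonneg_right
                (div_le_div_of_nonneg_right (hC₂ _) (hk k).le) (hk k).le
            · exact div_nonneg (div_nonneg hC₂0 (hk k).le) (hk k).le
            · exact div_le_div_of_nonneg_right (hC₁ _) (hk k).le
            · exact div_nonneg hC₁0 (hk k).le
        _ = (2 * C₂ + C₁ * n / 2) / (k + 1) + 2 * C₁ := by
            field_simp
            ring
        _ ≤ (2 * C₂ + C₁ * n / 2) + 2 * C₁ := by
            have : (2 * C₂ + C₁ * n / 2) / (k + 1) ≤ 2 * C₂ + C₁ * n / 2 :=
              div_le_self (by linarith) hkk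
            linarith
        _ ≤ C := by linarith
    · rw [(hfar k x hfx).1, (hfar k x hfx).2]
      simpa using hC0
  · -- `|g⁻¹(df, dη_k)| ≤ C`
    intro k x
    rw [hcross]
    by_cases hfx : f x ≤ 2 * (k + 1)
    · calc |deriv ψ (f x / (k + 1)) / (k + 1) * g.gradSq f x|
          = |deriv ψ (f x / (k + 1))| / (k + 1) * g.gradSq f x := by
            rw [abs_mul, abs_div, abs_of_pos (hk k), abs_of_nonneg (hG0 x)]
        _ ≤ C₁ / (k + 1) * (2 * (k + 1)) :=
            mul_le_mul (div_le_div_of_nonneg_right (hC₁ _) (hk k).le) ((hgrad x).trans hfx)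
              (hG0 x) (div_nonneg hC₁0 (hk k).le)
        _ = 2 * C₁ := by
            field_simp
        _ ≤ C := by linarith
    · rw [(hfar k x hfx).1]
      simpa using hC0

end Summit.SmoothPoincare4.SmoothPoincare4.Theorems.NoncompactShrinkerGapHeat

end
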